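import Summits.CriticalPhenomena.PercolationContinuityZ3.Theorems.Transplant.FKConnectivityAllQAntipodalX2SpineSem
import Summits.CriticalPhenomena.PercolationContinuityZ3.Theorems.Transplant.FKConnectivityAllQAntipodalX2SpineFiber
import Summits.CriticalPhenomena.PercolationContinuityZ3.Theorems.Transplant.FKConnectivityAllQAntipodalSplitSeries
import HarnessLib

/-!
# Connectivity correlation inequalities for `φ_{w,q}` — **`FK.ApX2Pos` HOLDS**: the four-terminal cross functional `X2` is nonnegative
# on two-terminal series–parallel networks for EVERY `q > 0` ((S4) of memo g13 §7.3: the summation)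

Theorem file (`--supports stmt-CriticalPhenomena-4575`), FK sub-lane `prim-bschramm-fk-2` (gen 14) of the post-continuity programme;
builds on p205010 (kernel theorem, internal audit signed; external expert review pending).  No definitions, no named facts, no sorries;
standard axioms.

THE THEOREM (`FK.apX2_nonneg_of_isTTSP`, `FK.apX2Pos_holds : ApX2Pos`).  For `E` two-terminal series–parallel between `s, t`
(`FK.IsTTSP`), a marked edge `uv ∈ E`, any `T ⊆ E ∖ uv`, every `q > 0` and every `g` monotone on the subsets of `T`:
`0 ≤ apX2 q T s t u v g = ∑_{B ⊆ T} q^{k(B)+k(T∖B)} 1{s ↔ t in B} 1{u ↮ v in T∖B} (g(B) - g(T∖B))` — the conjecture node of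
`…AntipodalSplitDefs` (gen 12), verified there coefficientwise by exhaustive computation and reduced to a word problem; the word
problem was solved in gen 13 (`FK.X2Word.sigma_wordHall`).  PROOF (memo g13 §5.1): along the spine `ps` of the marked edge
(`FK.exists_spine`), the summand factors through the σ-word `w(B)` of `B`: `1{s ↔ t in B} = lastP (row A)`, `1{u ↔ v in T∖B} = headP (row B)`
(`FK.IsSpine.apConn_terminals_eq`, `FK.IsSpine.apConn_marked_eq`) and `q^{k(B)+k(T∖B)} = wordCoef(w(B)) · q^{expSum B}`
(`FK.IsSpine.pow_apExp_eq`); the involution `B ↦ T ∖ B` exchanges the rows, so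
`apX2 = ∑_{w} wordCoef(w) · sSign(w) · fiberSum(w)` (`FK.IsSpine.apX2_eq_sum_words`) with `sSign = +1` on winners, `-1` on losers;
WORD-HALL gives an injection `Φ` of losers into winners with `wordCoef(Φ w) = wordCoef(w)` (same particle number, same runs) and
`fiberSum(w) ≤ fiberSum(Φ w)` (one application of Theorem U per flipped part, `FK.fiberSum_le_of_flip`); after normalising `g ≥ 0`
(the summand only sees `g(B) - g(T∖B)`) the loser sum is dominated by the winner sum.
CONSEQUENCES (kernel, previously conditional on the node): `FK.apV_nonneg` (the split antipodal functional, `0 < q ≤ 1`) and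
`FK.apUpcSplit_pendant_nonneg` (`U¹¹(y·M) ≥ 0`, the first case of the split up-correlation inequality of memo g11/g12).
[cite: Grimmett2006, §1.4 eq. (1.20) (p. 15); §3.8 Thm. (3.90) (pp. 61–62); §3.9 (p. 63)]
-/

noncomputable section

namespace Summit.CriticalPhenomena.PercolationContinuityZ3.Theorems

namespace FK

open SimpleGraph Literature.Probability.LatticeModels Literature.Probability.Percolation X2Word
open scoped Classical

variable {V : Type*} [Fintype V]

/-! ### The antipodal weight through the word -/

section Weight

variable {ps : List (SpinePart V)} {E T : Finset (Sym2 V)} {s t u v : V}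

omit [Fintype V] in
/-- The parts' exponents split into the `B`-half and the `T ∖ B`-half. [folklore] -/
theorem expSum_eq_two_sums (ps : List (SpinePart V)) (T B : Finset (Sym2 V)) :
    expSum ps T B = (ps.map fun p => clusterCount (↑(B ∩ p.R) : BondConfig V) ∅).sum +
      (ps.map fun p => clusterCount (↑((T \ B) ∩ p.R) : BondConfig V) ∅).sum := by
  induction ps with
  | nil => simp [expSum]
  | cons p ps ih =>
    rw [expSum_cons, ih, List.map_cons, List.map_cons, List.sum_cons, List.sum_cons]
    have hset : (T ∩ p.R) \ (B ∩ p.R) = (T \ B) ∩ p.R := by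
      ext e
      simp only [Finset.mem_sdiff, Finset.mem_inter, not_and]
      constructor
      · rintro ⟨⟨heT, heR⟩, h⟩; exact ⟨⟨heT, fun heB => h heB heR⟩, heR⟩
      · rintro ⟨⟨heT, heB⟩, heR⟩; exact ⟨⟨heT, heR⟩, fun h _ => heB h⟩
    unfold apExp
    rw [hset]
    omega

omit [Fintype V] in
/-- The parts' exponents are symmetric under `B ↦ T ∖ B`. [folklore] -/
theorem expSum_sdiff (ps : List (SpinePart V)) {T B : Finset (Sym2 V)} (hB : B ⊆ T) :
    expSum ps T (T \ B) = expSum ps T B := by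
  rw [expSum_eq_two_sums ps T (T \ B), expSum_eq_two_sums ps T B, Finset.sdiff_sdiff_eq_self hB, Nat.add_comm]

/-- **The antipodal exponent through the word**: `k(B) + k(T∖B) + 2LK + sRuns(w(B)) = 2K + expSum B + nP(w(B))` (`K = |V|`,
`L` the number of parts). [cite: Grimmett2006, §1.4 eq. (1.20) (p. 15)] -/
theorem IsSpine.apExp_identity (h : IsSpine ps {s(u, v)} u v E s t) (huv : u ≠ v) (hT : T ⊆ E.erase s(u, v))
    {B : Finset (Sym2 V)} (hB : B ⊆ T) :
    apExp T B + 2 * (ps.length * Fintype.card V) + sRuns (spineWord ps T B) =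
      2 * Fintype.card V + expSum ps T B + nP (spineWord ps T B) := by
  have hTE : T ⊆ E := hT.trans (Finset.erase_subset _ _)
  have hzT : s(u, v) ∉ T := fun hz => Finset.notMem_erase _ _ (hT hz)
  have k1 := h.clusterCount_marked huv (hB.trans hTE) (fun hz => hzT (hB hz))
  have k2 := h.clusterCount_marked huv (ω := T \ B) (Finset.sdiff_subset.trans hTE)
    (fun hz => hzT (Finset.sdiff_subset hz))
  rw [← sRowA_spineWord ps T B] at k1
  rw [← sRowB_spineWord ps T B] at k2
  have r1 := adjP_add_runsP (sRowA (spineWord ps T B))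
  have r2 := adjP_add_runsP (sRowB (spineWord ps T B))
  have e := expSum_eq_two_sums ps T B
  unfold apExp sRuns nP
  omega

/-- **`q^{k(B)+k(T∖B)} = wordCoef(w(B)) · q^{expSum B}`.** [cite: Grimmett2006, §1.4 eq. (1.20) (p. 15)] -/
theorem IsSpine.pow_apExp_eq (h : IsSpine ps {s(u, v)} u v E s t) (huv : u ≠ v) (hT : T ⊆ E.erase s(u, v)) {q : ℝ}
    (hq : 0 < q) {B : Finset (Sym2 V)} (hB : B ⊆ T) :
    q ^ apExp T B = wordCoef q (Fintype.card V) ps.length (spineWord ps T B) * q ^ expSum ps T B := by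
  have hN := h.apExp_identity huv hT hB
  have hN' : apExp T B + (2 * (ps.length * Fintype.card V) + sRuns (spineWord ps T B)) =
      (2 * Fintype.card V + nP (spineWord ps T B)) + expSum ps T B := by omega
  have key : q ^ apExp T B * q ^ (2 * (ps.length * Fintype.card V) + sRuns (spineWord ps T B)) =
      q ^ (2 * Fintype.card V + nP (spineWord ps T B)) * q ^ expSum ps T B := by
    rw [← pow_add, ← pow_add, hN']
  have hne : q ^ (2 * (ps.length * Fintype.card V) + sRuns (spineWord ps T B)) ≠ 0 := (pow_pos hq _).ne'
  rw [wordCoef, div_mul_eq_mul_div, eq_div_iff hne, key]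

omit [Fintype V] in
/-- The word coefficient is symmetric under row exchange. [folklore] -/
theorem wordCoef_map_swapLetter (q : ℝ) (K L : ℕ) (w : List SLetter) :
    wordCoef q K L (w.map swapLetter) = wordCoef q K L w := by
  unfold wordCoef; rw [nP_map_swapLetter, sRuns_map_swapLetter]

omit [Fintype V] in
/-- The word coefficient is positive (`q > 0`). [folklore] -/
theorem wordCoef_pos {q : ℝ} (hq : 0 < q) (K L : ℕ) (w : List SLetter) : 0 < wordCoef q K L w := by
  unfold wordCoef; exact div_pos (pow_pos hq _) (pow_pos hq _)

end Weight

/-! ### `apX2` as a signed sum over words -/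

section Words

variable {ps : List (SpinePart V)} {E T : Finset (Sym2 V)} {s t u v : V} {q : ℝ}

/-- **`apX2 = ∑_w wordCoef(w) · sSign(w) · fiberSum(w)`**: the summand of `apX2` factors through the word of the configuration; the
involution `B ↦ T ∖ B` exchanges the rows, turning the sign into `+1` on winners and `-1` on losers (memo g13 §5.1). [folklore] -/
theorem IsSpine.apX2_eq_sum_words (h : IsSpine ps {s(u, v)} u v E s t) (huv : u ≠ v) (hT : T ⊆ E.erase s(u, v))
    (hq : 0 < q) (g : Finset (Sym2 V) → ℝ) :
    apX2 q T s t u v g = ∑ w ∈ allWords ps,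
      wordCoef q (Fintype.card V) ps.length w * sSign w * fiberSum q ps T g w := by
  set K := Fintype.card V with hK
  set L := ps.length with hL
  have hTE : T ⊆ E := hT.trans (Finset.erase_subset _ _)
  have hzT : s(u, v) ∉ T := fun hz => Finset.notMem_erase _ _ (hT hz)
  -- the summand through the word
  have hsum : ∀ B ∈ T.powerset,
      q ^ apExp T B * (apConn B s t * (1 - apConn (T \ B) u v) * (g B - g (T \ B))) =
        wordCoef q K L (spineWord ps T B) * q ^ expSum ps T B *
          ((if lastP (sRowA (spineWord ps T B)) then (1 : ℝ) else 0) *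
            (1 - if headP (sRowB (spineWord ps T B)) then (1 : ℝ) else 0)) * g B -
        wordCoef q K L (spineWord ps T B) * q ^ expSum ps T B *
          ((if lastP (sRowA (spineWord ps T B)) then (1 : ℝ) else 0) *
            (1 - if headP (sRowB (spineWord ps T B)) then (1 : ℝ) else 0)) * g (T \ B) := by
    intro B hB
    rw [Finset.mem_powerset] at hB
    rw [h.pow_apExp_eq huv hT hq hB,
      h.apConn_terminals_eq huv (hB.trans hTE) (fun hz => hzT (hB hz)),
      h.apConn_marked_eq huv (ω := T \ B) (Finset.sdiff_subset.trans hTE) (fun hz => hzT (Finset.sdiff_subset hz)),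
      sRowA_spineWord, sRowB_spineWord]
    ring
  -- the `g(T ∖ B)`-half, re-indexed by `B ↦ T ∖ B`
  have hflip : ∑ B ∈ T.powerset, wordCoef q K L (spineWord ps T B) * q ^ expSum ps T B *
      ((if lastP (sRowA (spineWord ps T B)) then (1 : ℝ) else 0) *
        (1 - if headP (sRowB (spineWord ps T B)) then (1 : ℝ) else 0)) * g (T \ B) =
      ∑ B ∈ T.powerset, wordCoef q K L (spineWord ps T B) * q ^ expSum ps T B *
      ((if lastP (sRowA ((spineWord ps T B).map swapLetter)) then (1 : ℝ) else 0) *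
        (1 - if headP (sRowB ((spineWord ps T B).map swapLetter)) then (1 : ℝ) else 0)) * g B := by
    rw [sum_powerset_flip T (fun B => wordCoef q K L (spineWord ps T B) * q ^ expSum ps T B *
      ((if lastP (sRowA (spineWord ps T B)) then (1 : ℝ) else 0) *
        (1 - if headP (sRowB (spineWord ps T B)) then (1 : ℝ) else 0)) * g (T \ B))]
    refine Finset.sum_congr rfl fun B hB => ?_
    rw [Finset.mem_powerset] at hB
    simp only [spineWord_sdiff ps hB, expSum_sdiff ps hB, Finset.sdiff_sdiff_eq_self hB, wordCoef_map_swapLetter]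
  unfold apX2
  rw [Finset.sum_congr rfl hsum, Finset.sum_sub_distrib, hflip, ← Finset.sum_sub_distrib]
  -- group by words
  rw [← Finset.sum_fiberwise_of_maps_to (fun B _ => spineWord_mem_allWords ps T B)]
  refine Finset.sum_congr rfl fun w _ => ?_
  unfold fiberSum
  rw [Finset.mul_sum]
  refine Finset.sum_congr rfl fun B hB => ?_
  have hBw : spineWord ps T B = w := (Finset.mem_filter.1 hB).2
  rw [← cross_sub_cross_swap w, ← hBw]
  ring

end Words

/-! ### The theorem -/

section Main

variable {ps : List (SpinePart V)} {E T : Finset (Sym2 V)} {s t u v : V} {q : ℝ}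

/-- **`apX2 ≥ 0` along a spine**, for `g` monotone and nonnegative on the subsets of `T` (memo g13 §5.1: WORD-HALL + one Theorem U per
flipped part). [cite: Grimmett2006, §3.9 (p. 63)] -/
theorem IsSpine.apX2_nonneg (h : IsSpine ps {s(u, v)} u v E s t) (huv : u ≠ v) (hT : T ⊆ E.erase s(u, v)) (hq : 0 < q)
    {g : Finset (Sym2 V) → ℝ} (hg : ∀ ⦃A B : Finset (Sym2 V)⦄, A ⊆ B → B ⊆ T → g A ≤ g B) (hg0 : ∀ B ⊆ T, 0 ≤ g B) :
    0 ≤ apX2 q T s t u v g := by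
  set K := Fintype.card V with hK
  set L := ps.length with hL
  set A := allWords ps with hA
  rw [h.apX2_eq_sum_words huv hT hq g]
  -- split the signed sum into winners minus losers
  have hsplit : ∑ w ∈ A, wordCoef q K L w * sSign w * fiberSum q ps T g w =
      (∑ w ∈ A.filter (fun w => sIsWinner w = true), wordCoef q K L w * fiberSum q ps T g w) -
        ∑ w ∈ A.filter (fun w => sIsLoser w = true), wordCoef q K L w * fiberSum q ps T g w := by
    rw [Finset.sum_filter, Finset.sum_filter, ← Finset.sum_sub_distrib]
    refine Finset.sum_congr rfl fun w _ => ?_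
    unfold sSign
    split_ifs <;> ring
  rw [hsplit, sub_nonneg]
  -- data of the spine for Theorem U
  have hpw := h.pairwise_disjoint
  have hU := h.parts_isTTSP
  have hcov := h.cover_erase hT
  -- word-Hall, loser by loser
  have key : ∀ w ∈ A.filter (fun w => sIsLoser w = true),
      wordCoef q K L w * fiberSum q ps T g w ≤ wordCoef q K L (sigmaPhi w) * fiberSum q ps T g (sigmaPhi w) ∧
        sigmaPhi w ∈ A.filter (fun w => sIsWinner w = true) := by
    intro w hw
    rw [Finset.mem_filter] at hw
    obtain ⟨hwin, hruns, hfl, -⟩ := sigma_wordHall w hw.2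
    have hcoef : wordCoef q K L (sigmaPhi w) = wordCoef q K L w := by
      unfold wordCoef; rw [nP_eq_of_forall₂_flip hfl, hruns]
    refine ⟨?_, Finset.mem_filter.2 ⟨mem_allWords_of_forall₂_flip hw.1 hfl, hwin⟩⟩
    rw [hcoef]
    exact mul_le_mul_of_nonneg_left (fiberSum_le_of_flip hq ps T g w (sigmaPhi w) hpw hU hcov hg hw.1 hfl)
      (wordCoef_pos hq K L w).le
  have hinj : ∀ w₁ ∈ A.filter (fun w => sIsLoser w = true), ∀ w₂ ∈ A.filter (fun w => sIsLoser w = true),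
      sigmaPhi w₁ = sigmaPhi w₂ → w₁ = w₂ := by
    intro w₁ hw₁ w₂ hw₂ heq
    exact (sigma_wordHall w₂ (Finset.mem_filter.1 hw₂).2).2.2.2 w₁ (Finset.mem_filter.1 hw₁).2 heq
  calc ∑ w ∈ A.filter (fun w => sIsLoser w = true), wordCoef q K L w * fiberSum q ps T g w
      ≤ ∑ w ∈ A.filter (fun w => sIsLoser w = true), wordCoef q K L (sigmaPhi w) * fiberSum q ps T g (sigmaPhi w) :=
        Finset.sum_le_sum fun w hw => (key w hw).1
    _ = ∑ w ∈ (A.filter (fun w => sIsLoser w = true)).image sigmaPhi, wordCoef q K L w * fiberSum q ps T g w := by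
        rw [Finset.sum_image hinj]
    _ ≤ ∑ w ∈ A.filter (fun w => sIsWinner w = true), wordCoef q K L w * fiberSum q ps T g w := by
        refine Finset.sum_le_sum_of_subset_of_nonneg ?_ fun w _ _ => ?_
        · intro w hw
          obtain ⟨w₀, hw₀, rfl⟩ := Finset.mem_image.1 hw
          exact (key w₀ hw₀).2
        · exact mul_nonneg (wordCoef_pos hq K L w).le (fiberSum_nonneg hq.le ps hg0 w)

omit [Fintype V] in
/-- `apX2` only sees the differences `g(B) - g(T∖B)`: shifting `g` by a constant does not change it. [folklore] -/
theorem apX2_sub_const (q : ℝ) (T : Finset (Sym2 V)) (s t u v : V) (g : Finset (Sym2 V) → ℝ) (c : ℝ) :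
    apX2 q T s t u v (fun B => g B - c) = apX2 q T s t u v g := by
  unfold apX2
  refine Finset.sum_congr rfl fun B _ => ?_
  ring

omit [Fintype V] in
/-- `apX2` is symmetric in the marked pair. [folklore] -/
theorem apX2_swap (q : ℝ) (T : Finset (Sym2 V)) (s t u v : V) (g : Finset (Sym2 V) → ℝ) :
    apX2 q T s t v u g = apX2 q T s t u v g := by
  unfold apX2 apConn
  refine Finset.sum_congr rfl fun B _ => ?_
  simp only [SimpleGraph.reachable_comm (u := v) (v := u)]

/-- **THEOREM (`X2 ≥ 0` on two-terminal series–parallel networks, every `q > 0`).**  For `E` two-terminal series–parallel between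
`s, t`, a marked edge `uv ∈ E`, `T ⊆ E ∖ uv`, `q > 0` and `g` monotone on the subsets of `T`:
`0 ≤ apX2 q T s t u v g = ∑_{B ⊆ T} q^{k(B)+k(T∖B)} 1{s ↔ t in B} 1{u ↮ v in T∖B} (g(B) - g(T∖B))`.
Proof: spine of the marked edge (`FK.exists_spine`), words (`FK.IsSpine.apX2_eq_sum_words`), WORD-HALL (`FK.X2Word.sigma_wordHall`) and
one Theorem U per flipped part (`FK.fiberSum_le_of_flip`), after normalising `g(∅) = 0`. [cite: Grimmett2006, §3.9 (p. 63)] -/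
theorem apX2_nonneg_of_isTTSP (hq : 0 < q) (hE : IsTTSP E s t) (huv : s(u, v) ∈ E) (hT : T ⊆ E.erase s(u, v))
    {g : Finset (Sym2 V) → ℝ} (hg : ∀ ⦃A B : Finset (Sym2 V)⦄, A ⊆ B → B ⊆ T → g A ≤ g B) :
    0 ≤ apX2 q T s t u v g := by
  -- normalise `g(∅) = 0`, so that `g ≥ 0` on the subsets of `T`
  rw [← apX2_sub_const q T s t u v g (g ∅)]
  have hg' : ∀ ⦃A B : Finset (Sym2 V)⦄, A ⊆ B → B ⊆ T → g A - g ∅ ≤ g B - g ∅ :=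
    fun A B hAB hB => sub_le_sub_right (hg hAB hB) _
  have hg0 : ∀ B ⊆ T, 0 ≤ g B - g ∅ := fun B hB => sub_nonneg.2 (hg (Finset.empty_subset B) hB)
  have hne : u ≠ v := fun h => hE.not_isDiag huv (Sym2.mk_isDiag_iff.2 h)
  obtain ⟨ps, hsp | hsp⟩ := exists_spine hE huv
  · exact hsp.apX2_nonneg hne hT hq hg' hg0
  · rw [← apX2_swap]
    rw [Sym2.eq_swap] at hsp hT
    exact hsp.apX2_nonneg hne.symm hT hq hg' hg0

/-- **`FK.ApX2Pos` holds** (the conjecture node of `…AntipodalSplitDefs`, gen 12, is a theorem). [cite: Grimmett2006, §3.9 (p. 63)] -/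
theorem apX2Pos_holds : ApX2Pos := by
  intro n q hq E s t u v hE huv T hT g hg
  refine apX2_nonneg_of_isTTSP hq hE huv (fun e he => ?_) hg
  have h1 := hT he
  simp only [Finset.mem_erase] at h1 ⊢
  exact h1

end Main

/-! ### Consequences: the split antipodal functional and `U¹¹(y·M)` -/

section Consequences

variable {E T : Finset (Sym2 V)} {s t u v : V} {q : ℝ}

/-- **The split antipodal functional is nonnegative** (`0 < q ≤ 1`): `0 ≤ apV q T s t u v g` for `T ⊆ E ∖ uv`, `E` TTSP between `s, t`,
`uv ∈ E`, `g` monotone — unconditionally (was `apV_nonneg_of_apX2Pos`). [cite: Grimmett2006, §3.8 (pp. 61–62); §3.9 (p. 63)] -/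
theorem apV_nonneg (hq0 : 0 < q) (hq1 : q ≤ 1) (hE : IsTTSP E s t) (huv : s(u, v) ∈ E) (hT : T ⊆ E.erase s(u, v))
    {g : Finset (Sym2 V) → ℝ} (hg : ∀ ⦃A B : Finset (Sym2 V)⦄, A ⊆ B → B ⊆ T → g A ≤ g B) :
    0 ≤ apV q T s t u v g :=
  apV_nonneg_of_apX2_nonneg hq0 hq1 hE (hT.trans (Finset.erase_subset _ _)) u v hg (apX2_nonneg_of_isTTSP hq0 hE huv hT hg)

/-- **`U¹¹(y·M) ≥ 0`, unconditionally** (`0 < q ≤ 1`): for `M` two-terminal series–parallel between `s, t` with a marked edge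
`z = uv ∈ M`, a new vertex `s₀` joined to `s` by the pendant edge `y = s₀s`, and a test function `h` on the configurations of `y·M`
whose sections over `y` and over `z` agree with a function `g` monotone on the subsets of `M ∖ z`: the split up-correlation functional
of `…AntipodalSplitSeries` is nonnegative — the first case of the split up-correlation inequality of memo g11 §3 / g12 §0
(was `apUpcSplit_pendant_nonneg_of_apX2_nonneg`). [cite: Grimmett2006, §3.8 (pp. 61–62); §3.9 (p. 63)] -/
theorem apUpcSplit_pendant_nonneg (hq0 : 0 < q) (hq1 : q ≤ 1) {M : Finset (Sym2 V)} {s₀ : V} (hM : IsTTSP M s t)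
    (huv : s(u, v) ∈ M) (hs₀ : ∀ e ∈ M, s₀ ∉ e) {h g : Finset (Sym2 V) → ℝ}
    (hhy : ∀ A ⊆ M.erase s(u, v), h (insert s(s₀, s) A) = g A) (hhz : ∀ A ⊆ M.erase s(u, v), h (insert s(u, v) A) = g A)
    (hg : ∀ ⦃A B : Finset (Sym2 V)⦄, A ⊆ B → B ⊆ M.erase s(u, v) → g A ≤ g B) :
    0 ≤ apUpcSplit q (insert s(s₀, s) M) s₀ t s(s₀, s) s(u, v) h := by
  have hX := apX2_nonneg_of_isTTSP hq0 hM huv subset_rfl hg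
  have hs : s₀ ≠ s := ne_of_not_mem_span hs₀ hM.left_mem
  have ht : s₀ ≠ t := ne_of_not_mem_span hs₀ hM.right_mem
  have hu : s₀ ≠ u := ne_of_not_mem_span hs₀ ⟨_, huv, Sym2.mem_mk_left _ _⟩
  have hv : s₀ ≠ v := ne_of_not_mem_span hs₀ ⟨_, huv, Sym2.mem_mk_right _ _⟩
  have key := apUpcSplit_pendant_nonneg_of_apX2_nonneg hq0 hq1 hM (Finset.erase_subset _ _)
    (fun e he => hs₀ e (Finset.mem_of_mem_erase he)) (Finset.notMem_erase _ _) hs ht hu hv hhy hhz hg hX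
  rwa [Finset.insert_erase huv] at key

end Consequences

end FK

end Summit.CriticalPhenomena.PercolationContinuityZ3.Theorems

end
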